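/-
Copyright (c) 2026 the pub-hodgecm-mathlib formalisation cell (harness21).  Prover seat hodgecm-mathlib-K2E3-p23 (g5), HCML Track B «K2-LIT» ∕ h413
(`stmt-HodgeConjecture-24833`), line `K2_E3_EllipticInputs`, unit U12 «Characters», road «GL-[M6]-sc» (line lead K2E3-p23 (g5), dealer K2E3-plan (g3)),
MEMO «M6sc-BLUEPRINT v4» §2 brick VOL-mixed, FILE B: the `x`-SECTION of the Levi count at the companion normal form.  2026-09-04.
-/
import Summits.HodgeConjecture.HodgeConjecture.Theorems.K2E3GL3MixedShearCount             -- ★ FILE A (this seat): entries of `M_{(2,1)}`; brings ★ B4-0 `adBall` kit, ★ V0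
import Summits.HodgeConjecture.HodgeConjecture.Theorems.K2E3GL2EllipticConjugacyCountSharp  -- ★ FILE 2 (this seat): the sharp per-shell count; brings FILE 1 §6 and the `normAbs` kit
import Literature.NumberTheory.Automorphic.GL3UpperUnipotentTwistedConjugation            -- ★ `mem_standardLeviGL_of_eq_transvection`
import Literature.NumberTheory.Automorphic.ValuedFieldValuativeRelBridge                  -- ★ `v_le_one_iff_mem_integer`
import HarnessLib

/-!
# Road «GL-[M6]-sc», brick VOL-mixed, FILE B: THE `x`-SECTION — `μ_F {x : 𝔅_m((τ_x a) γ (τ_x a)⁻¹)} ≤ |2|⁻¹ (q⁻¹)^{B − l + ⌊l/2⌋} μ_F(𝒪)` UNIFORMLY IN `a ∈ A`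

Cell `pub/hodgecm-mathlib` (D-0151), Track B «K2-LIT», crux H413 = `stmt-HodgeConjecture-24833`, route of record `HCCMUnconditional`.  Lane
`--supports stmt-HodgeConjecture-24833 --as helper`; THEOREMS ONLY (no `def`, no `instance`, no `notation`, no named-fact hypothesis, no `sorry`); count-neutral.

WHAT.  `γ` the companion normal form of a mixed regular element (`(γ : Matrix) = !![0, −N₀, 0; 1, T, 0; 0, 0, c]`, `π = X² − TX + N₀` without a root in `F`, RULINGS (M12-5)),
`a = diag(d)` a point of the diagonal torus `A`, `τ_x = 1 + x E₀₁` the root-group element of `N_M = N₃ ∩ M_{(2,1)}`.  Then (§1, pure algebra over a field)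
`(τ_x a) γ (τ_x a)⁻¹ = !![x/r, −N₀ r + T x − x²/r, 0; 1/r, T − x/r, 0; 0, 0, c]`, `r = d₀/d₁` — so its `(0,1)` entry is `−r · π(x/r)` and the `(2,2)` entry of its inverse is
`c⁻¹` (it lies in `M_{(2,1)}`).  Hence (§2) the height-ball condition `𝔅_m((τ_x a) γ (τ_x a)⁻¹)` forces `|r| · |π(x/r)| ≤ |c|·|ϖ|^{-m} =: (q⁻¹)^B`, the `x`-section is the
dilate `r • {x′ : |r||π(x′)| ≤ (q⁻¹)^B}` of mass `|r| · μ_F{…}` (Tate), and ★ FILE 2 `normAbs_mul_measure_setOf_mul_le_of_sq_le` (fed by `(q⁻¹)^l ≤ |π|` and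
`|2x′ − T|² ≤ |π(x′)|`, ★ `sq_normAbs_deriv_le_normAbs_eval`) bounds it by `|2|⁻¹ (q⁻¹)^{B − l + ⌊l/2⌋} μ_F(𝒪)` FOR EVERY `a`:
* `coe_transvection_mul_diagonal_conj` — the matrix of `(τ_x a) γ (τ_x a)⁻¹`;
* `normAbs_mul_eval_le_of_adBall_conj` — `𝔅_m(…) ⇒ |r·π(x/r)| ≤ |c (ϖ^m)⁻¹|`;
* **`measure_section_adBall_conj_le`** — THE HEAD (uniform in `a`); with ★ V3 `measure_window_adBall_le` it gives the `(a, x)`-count `≤ |W|(2R+1)² α(A(𝒪)) ·` that constant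
  (FILE C, the assembly over ★ V1 `K·N·A` and ★ FILE A).
HONEST LABEL: HC_CM is proved only modulo the 7 printed citations (2 remaining named inputs: hLiu418 = stmt-HodgeConjecture-24832, h413 = stmt-HodgeConjecture-24833) until
rung 0 closes; count-neutral helper, closes no socket.

## References
* [HarishChandra1970] Harish-Chandra (notes by G. van Dijk), *Harmonic Analysis on Reductive p-adic Groups*, LNM 162 (1970), Part VII §1 Theorem 14 p. 60, §3 p. 72.
* [Tate1950] J. Tate, *Fourier analysis in number fields and Hecke's zeta-functions* (1950), §2.2 Lemma 2.2.5.
-/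

set_option autoImplicit false
-- the mandated namespace repeats the single-problem summit's segment (`HodgeConjecture.HodgeConjecture`)
set_option linter.dupNamespace false

noncomputable section

open MeasureTheory Measure Set Function Topology
open scoped MatrixGroups NNReal ENNReal WithZero Pointwise
open Matrix ValuativeRel
open Literature.NumberTheory.Automorphic Literature.NumberTheory.GaloisRepresentations Literature.NumberTheory.GaloisRepresentations.IsNonarchimedeanLocalField
open Summit.HodgeConjecture.HodgeConjecture.Cruxes.H413.K2E3GLnAdHeightBalls Summit.HodgeConjecture.HodgeConjecture.Cruxes.H413.K2E3GLnUnipotentAdHeight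
open Summit.HodgeConjecture.HodgeConjecture.Cruxes.H413.K2E3GL2EllipticConjugacyCount Summit.HodgeConjecture.HodgeConjecture.Cruxes.H413.K2E3GL2EllipticConjugacyCountSharp
open Summit.HodgeConjecture.HodgeConjecture.Cruxes.H413.K2E3GL3MixedShearCount

namespace Summit.HodgeConjecture.HodgeConjecture.Cruxes.H413.K2E3GL3MixedLeviSectionCount

/-! ## §1 The conjugate `(τ_x a) γ (τ_x a)⁻¹` in coordinates -/

section Algebra

variable {F : Type*} [Field F]

/-- The transvection `τ_x = 1 + x E₀₁` as an explicit `3 × 3` matrix. [folklore] -/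
theorem transvection_zero_one_eq (x : F) : (Matrix.transvection (0 : Fin 3) 1 x : Matrix (Fin 3) (Fin 3) F) = !![1, x, 0; 0, 1, 0; 0, 0, 1] := by
  ext i j
  fin_cases i <;> fin_cases j <;> simp [Matrix.transvection, Matrix.single]

/-- The inverse of a unit whose matrix is `τ_x` has matrix `τ_{−x}`. [folklore] -/
theorem coe_inv_of_coe_eq_transvection {v : GL (Fin 3) F} {x : F} (hv : (v : Matrix (Fin 3) (Fin 3) F) = Matrix.transvection 0 1 x) :
    ((v⁻¹ : GL (Fin 3) F) : Matrix (Fin 3) (Fin 3) F) = Matrix.transvection 0 1 (-x) := by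
  refine Units.inv_eq_of_mul_eq_one_right ?_
  rw [hv, Matrix.transvection_mul_transvection_same _ _ (by decide), add_neg_cancel, Matrix.transvection_zero]

/-- **The conjugate in coordinates**: for `(v : Matrix) = τ_x`, `(a : Matrix) = diag d`, `(γ : Matrix) = !![0, −N₀, 0; 1, T, 0; 0, 0, c]`,
`((v a) γ (v a)⁻¹ : Matrix) = !![x d₁/d₀, −N₀ d₀/d₁ + T x − x² d₁/d₀, 0; d₁/d₀, T − x d₁/d₀, 0; 0, 0, c]`. [cite: HarishChandra1970, Part VII §3 p. 72] -/
theorem coe_transvection_mul_diagonal_conj {v a γ : GL (Fin 3) F} {x : F} {d : Fin 3 → F} {T N₀ c : F}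
    (hv : (v : Matrix (Fin 3) (Fin 3) F) = Matrix.transvection 0 1 x) (ha : (a : Matrix (Fin 3) (Fin 3) F) = Matrix.diagonal d)
    (hγ : (γ : Matrix (Fin 3) (Fin 3) F) = !![0, -N₀, 0; 1, T, 0; 0, 0, c]) :
    (((v * a) * γ * (v * a)⁻¹ : GL (Fin 3) F) : Matrix (Fin 3) (Fin 3) F) =
      !![x * (d 1 / d 0), -N₀ * (d 0 / d 1) + T * x - x ^ 2 * (d 1 / d 0), 0; d 1 / d 0, T - x * (d 1 / d 0), 0; 0, 0, c] := by
  have hd : ∀ i, d i ≠ 0 := ne_zero_of_coe_eq_diagonal ha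
  have hai : ((a⁻¹ : GL (Fin 3) F) : Matrix (Fin 3) (Fin 3) F) = Matrix.diagonal fun i => (d i)⁻¹ := coe_inv_eq_diagonal_inv ha
  have hvi := coe_inv_of_coe_eq_transvection hv
  rw [_root_.mul_inv_rev, Units.val_mul, Units.val_mul, Units.val_mul, Units.val_mul, hv, ha, hγ, hai, hvi, transvection_zero_one_eq, transvection_zero_one_eq]
  have hD : (Matrix.diagonal d : Matrix (Fin 3) (Fin 3) F) = !![d 0, 0, 0; 0, d 1, 0; 0, 0, d 2] := by
    ext i j; fin_cases i <;> fin_cases j <;> simp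
  have hDi : (Matrix.diagonal (fun i => (d i)⁻¹) : Matrix (Fin 3) (Fin 3) F) = !![(d 0)⁻¹, 0, 0; 0, (d 1)⁻¹, 0; 0, 0, (d 2)⁻¹] := by
    ext i j; fin_cases i <;> fin_cases j <;> simp
  rw [hD, hDi]
  ext i j
  fin_cases i <;> fin_cases j <;> simp [Matrix.mul_apply, Fin.sum_univ_three] <;> field_simp [hd 0, hd 1, hd 2] <;> ring

/-- The conjugate lies in the Levi `M_{(2,1)}` (its matrix is block diagonal). [cite: BernsteinZelevinsky1977, §2.1] -/
theorem conj_mem_standardLeviGL {v a γ : GL (Fin 3) F} {x : F} {d : Fin 3 → F} {T N₀ c : F}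
    (hv : (v : Matrix (Fin 3) (Fin 3) F) = Matrix.transvection 0 1 x) (ha : (a : Matrix (Fin 3) (Fin 3) F) = Matrix.diagonal d)
    (hγ : (γ : Matrix (Fin 3) (Fin 3) F) = !![0, -N₀, 0; 1, T, 0; 0, 0, c]) :
    ((v * a) * γ * (v * a)⁻¹ : GL (Fin 3) F) ∈ standardLeviGL F (![false, false, true] : Fin 3 → Bool) := by
  rw [mem_standardLeviGL_iff, coe_transvection_mul_diagonal_conj hv ha hγ]
  intro i j hij
  fin_cases i <;> fin_cases j <;> simp_all

/-- `(g⁻¹)₂₂ = c⁻¹` for the conjugate `g` (it lies in `M_{(2,1)}` with `g₂₂ = c`). [folklore] -/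
theorem inv_apply_two_two_conj {v a γ : GL (Fin 3) F} {x : F} {d : Fin 3 → F} {T N₀ c : F}
    (hv : (v : Matrix (Fin 3) (Fin 3) F) = Matrix.transvection 0 1 x) (ha : (a : Matrix (Fin 3) (Fin 3) F) = Matrix.diagonal d)
    (hγ : (γ : Matrix (Fin 3) (Fin 3) F) = !![0, -N₀, 0; 1, T, 0; 0, 0, c]) :
    ((((v * a) * γ * (v * a)⁻¹)⁻¹ : GL (Fin 3) F) : Matrix (Fin 3) (Fin 3) F) 2 2 = c⁻¹ := by
  have h := apply_two_two_mul_inv_apply_two_two (conj_mem_standardLeviGL hv ha hγ)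
  rw [coe_transvection_mul_diagonal_conj hv ha hγ] at h
  have h22 : (!![x * (d 1 / d 0), -N₀ * (d 0 / d 1) + T * x - x ^ 2 * (d 1 / d 0), 0; d 1 / d 0, T - x * (d 1 / d 0), 0; 0, 0, c] : Matrix (Fin 3) (Fin 3) F) 2 2 = c := by
    simp
  rw [h22] at h
  exact (inv_eq_of_mul_eq_one_right h).symm

/-- The `(0,1)` entry of the conjugate is `−r · π(x/r)`, `r = d₀/d₁`. [cite: HarishChandra1970, Part VII §3 p. 72] -/
theorem conj_apply_zero_one {v a γ : GL (Fin 3) F} {x : F} {d : Fin 3 → F} {T N₀ c : F}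
    (hv : (v : Matrix (Fin 3) (Fin 3) F) = Matrix.transvection 0 1 x) (ha : (a : Matrix (Fin 3) (Fin 3) F) = Matrix.diagonal d)
    (hγ : (γ : Matrix (Fin 3) (Fin 3) F) = !![0, -N₀, 0; 1, T, 0; 0, 0, c]) :
    (((v * a) * γ * (v * a)⁻¹ : GL (Fin 3) F) : Matrix (Fin 3) (Fin 3) F) 0 1 =
      -(d 0 / d 1) * ((x / (d 0 / d 1)) ^ 2 - T * (x / (d 0 / d 1)) + N₀) := by
  have hd : ∀ i, d i ≠ 0 := ne_zero_of_coe_eq_diagonal ha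
  rw [coe_transvection_mul_diagonal_conj hv ha hγ]
  simp only [Matrix.of_apply, Matrix.cons_val', Matrix.cons_val_zero, Matrix.cons_val_one, Matrix.empty_val', Matrix.cons_val_fin_one]
  field_simp [hd 0, hd 1]
  ring

end Algebra

/-! ## §2 The section bound -/

section Section

variable {F : Type*} [Field F] [Valued F ℤᵐ⁰] [ValuativeRel F] [(Valued.v : Valuation F ℤᵐ⁰).Compatible] [IsNonarchimedeanLocalField F]

/-- Bridge: `Valued.v (ϖ^m · y · c⁻¹) ≤ 1 ⇒ |y| ≤ |c · (ϖ^m)⁻¹|` (`c`, `ϖ` non-zero). [folklore] -/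
theorem normAbs_le_of_v_le_one {ϖ c y : F} (hϖ0 : ϖ ≠ 0) (hc : c ≠ 0) {m : ℕ} (h : Valued.v (ϖ ^ m * y * c⁻¹) ≤ 1) :
    normAbs F y ≤ normAbs F (c * (ϖ ^ m)⁻¹) := by
  have h1 : normAbs F (ϖ ^ m * y * c⁻¹) ≤ 1 := normAbs_le_one_iff.2 ((v_le_one_iff_mem_integer _).1 h)
  have hϖm : normAbs F (ϖ ^ m) ≠ 0 := (map_ne_zero (normAbs F)).2 (pow_ne_zero _ hϖ0)
  have hcn : normAbs F c ≠ 0 := (map_ne_zero (normAbs F)).2 hc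
  rw [map_mul, map_mul, map_inv₀] at h1
  rw [map_mul, map_inv₀]
  have hpos : 0 < normAbs F (ϖ ^ m) := pos_iff_ne_zero.2 hϖm
  have hcpos : 0 < normAbs F c := pos_iff_ne_zero.2 hcn
  rw [mul_inv_le_iff₀ hcpos, one_mul] at h1
  rw [le_mul_inv_iff₀ hpos]
  rwa [mul_comm] at h1

/-- **`𝔅_m((τ_x a) γ (τ_x a)⁻¹) ⇒ |r · π(x/r)| ≤ |c (ϖ^m)⁻¹|`** (`r = d₀/d₁`): the `(0,1) × (2,2)` product among the `𝔅_m` bounds. [cite: HarishChandra1970, Part VII §3 p. 72] -/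
theorem normAbs_mul_eval_le_of_adBall_conj {ϖ : F} (hϖ0 : ϖ ≠ 0) {m : ℕ} {v a γ : GL (Fin 3) F} {x : F} {d : Fin 3 → F} {T N₀ c : F} (hc : c ≠ 0)
    (hv : (v : Matrix (Fin 3) (Fin 3) F) = Matrix.transvection 0 1 x) (ha : (a : Matrix (Fin 3) (Fin 3) F) = Matrix.diagonal d)
    (hγ : (γ : Matrix (Fin 3) (Fin 3) F) = !![0, -N₀, 0; 1, T, 0; 0, 0, c])
    (h : ∀ i j k l, Valued.v (ϖ ^ m * ((((v * a) * γ * (v * a)⁻¹ : GL (Fin 3) F) : Matrix (Fin 3) (Fin 3) F) i j *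
      ((((v * a) * γ * (v * a)⁻¹)⁻¹ : GL (Fin 3) F) : Matrix (Fin 3) (Fin 3) F) k l)) ≤ 1) :
    normAbs F ((d 0 / d 1) * ((x / (d 0 / d 1)) ^ 2 - T * (x / (d 0 / d 1)) + N₀)) ≤ normAbs F (c * (ϖ ^ m)⁻¹) := by
  have h01 := h 0 1 2 2
  rw [conj_apply_zero_one hv ha hγ, inv_apply_two_two_conj hv ha hγ, ← mul_assoc] at h01
  have := normAbs_le_of_v_le_one hϖ0 hc h01
  rwa [neg_mul, normAbs_neg] at this

variable [MeasurableSpace F] [BorelSpace F]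

/-- **THE `x`-SECTION BOUND, UNIFORM IN `a ∈ A`.**  For `π = X² − TX + N₀` without a root in `F` (`2 ≠ 0`), the companion `γ` (`(γ : Matrix) = !![0, −N₀, 0; 1, T, 0; 0, 0, c]`,
`c ≠ 0`), `τ_x` the root-group element (`(w x : Matrix) = τ_x`), any `a = diag d`, and integers `B`, `l` with `|c (ϖ^m)⁻¹| = (q⁻¹)^B`, `(q⁻¹)^l ≤ |π(x′)|` for all `x′`:
`μ_F {x : 𝔅_m((τ_x a) γ (τ_x a)⁻¹)} ≤ |2|⁻¹ · (q⁻¹)^{B − l + ⌊l/2⌋} · μ_F(𝒪)` — the section is the dilate `r • {x′ : |r||π(x′)| ≤ (q⁻¹)^B}` (`r = d₀/d₁`), of mass `|r| μ_F{…}`, and ★ FILE 2's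
sharp per-shell count applies. [cite: HarishChandra1970, Part VII §1 Theorem 14 p. 60; §3 p. 72] [cite: Tate1950, §2.2 Lemma 2.2.5] -/
theorem measure_section_adBall_conj_le (μF : Measure F) [μF.IsAddHaarMeasure] (h2 : (2 : F) ≠ 0) {ϖ : F} (hϖ0 : ϖ ≠ 0) {m : ℕ}
    {T N₀ c : F} (hπ : ∀ x : F, x ^ 2 - T * x + N₀ ≠ 0) (hc : c ≠ 0)
    {γ : GL (Fin 3) F} (hγ : (γ : Matrix (Fin 3) (Fin 3) F) = !![0, -N₀, 0; 1, T, 0; 0, 0, c])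
    (w : F → GL (Fin 3) F) (hw : ∀ x, ((w x : GL (Fin 3) F) : Matrix (Fin 3) (Fin 3) F) = Matrix.transvection 0 1 x)
    {B : ℤ} (hB : normAbs F (c * (ϖ ^ m)⁻¹) = ((residueFieldCard F : ℝ≥0)⁻¹) ^ B)
    {l : ℕ} (hl : ∀ x : F, ((residueFieldCard F : ℝ≥0)⁻¹) ^ (l : ℤ) ≤ normAbs F (x ^ 2 - T * x + N₀))
    (a : GL (Fin 3) F) {d : Fin 3 → F} (ha : (a : Matrix (Fin 3) (Fin 3) F) = Matrix.diagonal d) :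
    μF {x | ∀ i j k l', Valued.v (ϖ ^ m * ((((w x * a) * γ * (w x * a)⁻¹ : GL (Fin 3) F) : Matrix (Fin 3) (Fin 3) F) i j *
        ((((w x * a) * γ * (w x * a)⁻¹)⁻¹ : GL (Fin 3) F) : Matrix (Fin 3) (Fin 3) F) k l')) ≤ 1} ≤
      (((normAbs F (2 : F))⁻¹ * ((residueFieldCard F : ℝ≥0)⁻¹) ^ (B - l + l / 2) : ℝ≥0) : ℝ≥0∞) * μF {b : F | normAbs F b ≤ 1} := by
  have hd : ∀ i, d i ≠ 0 := ne_zero_of_coe_eq_diagonal ha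
  set r : F := d 0 / d 1 with hr
  have hr0 : r ≠ 0 := div_ne_zero (hd 0) (hd 1)
  -- the section sits in the dilate `r • {x′ : |r| |π x′| ≤ (q⁻¹)^B}`
  set Φ : F → ℝ≥0 := fun x' => normAbs F (x' ^ 2 - T * x' + N₀) with hΦ
  have hsub : {x | ∀ i j k l', Valued.v (ϖ ^ m * ((((w x * a) * γ * (w x * a)⁻¹ : GL (Fin 3) F) : Matrix (Fin 3) (Fin 3) F) i j *
        ((((w x * a) * γ * (w x * a)⁻¹)⁻¹ : GL (Fin 3) F) : Matrix (Fin 3) (Fin 3) F) k l')) ≤ 1} ⊆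
      r • {x' : F | normAbs F ((Units.mk0 r hr0 : Fˣ) : F) * Φ x' ≤ ((residueFieldCard F : ℝ≥0)⁻¹) ^ B} := by
    intro x hx
    rw [Set.mem_smul_set_iff_inv_smul_mem₀ hr0, Set.mem_setOf_eq, smul_eq_mul, Units.val_mk0, hΦ]
    have key := normAbs_mul_eval_le_of_adBall_conj hϖ0 hc (hw x) ha hγ hx
    rw [hB, map_mul] at key
    simp only
    rwa [div_eq_inv_mul x r] at key
  -- its shell index
  obtain ⟨j, hj⟩ := exists_normAbs_eq_inv_zpow (Units.mk0 r hr0).ne_zero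
  have hΦ₂ : ∀ b : F, normAbs F (2 * b + -T) ^ 2 ≤ Φ b := fun b => by
    rw [hΦ, show (2 : F) * b + -T = 2 * b - T by ring]
    exact sq_normAbs_deriv_le_normAbs_eval hπ b
  have hshell := normAbs_mul_measure_setOf_mul_le_of_sq_le μF (Φ := Φ) (l := l) (B := B) (t := -T) h2 hl hΦ₂ hj
  calc μF {x | ∀ i j k l', Valued.v (ϖ ^ m * ((((w x * a) * γ * (w x * a)⁻¹ : GL (Fin 3) F) : Matrix (Fin 3) (Fin 3) F) i j *
          ((((w x * a) * γ * (w x * a)⁻¹)⁻¹ : GL (Fin 3) F) : Matrix (Fin 3) (Fin 3) F) k l')) ≤ 1}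
      ≤ μF (r • {x' : F | normAbs F ((Units.mk0 r hr0 : Fˣ) : F) * Φ x' ≤ ((residueFieldCard F : ℝ≥0)⁻¹) ^ B}) := measure_mono hsub
    _ = (normAbs F ((Units.mk0 r hr0 : Fˣ) : F) : ℝ≥0∞) * μF {x' : F | normAbs F ((Units.mk0 r hr0 : Fˣ) : F) * Φ x' ≤ ((residueFieldCard F : ℝ≥0)⁻¹) ^ B} := by
        rw [addHaar_smul_set μF hr0, Units.val_mk0]
    _ ≤ _ := hshell.trans ?_
  split_ifs
  · exact bot_le
  · exact le_rfl

end Section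

end Summit.HodgeConjecture.HodgeConjecture.Cruxes.H413.K2E3GL3MixedLeviSectionCount

end
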